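import Literature.MathematicalPhysics.QuantumLattice.LadderWordCharge
import HarnessLib

/-!
# The discrete `U(1)` gauge rotation of fermionic Fock space (`c ↦ i·c`)

The global gauge (particle-number) symmetry `c_j ↦ e^{-iθ} c_j` of every number-conserving lattice
fermion Hamiltonian is implemented on Fock space by `e^{iθ N̂}`. This file types its QUARTER-TURN
powers — the only ones a square-lattice `d`-wave programme needs (the `B₁g` form factor changes sign
under the quarter turn of the lattice, and the gauge quarter turn `c ↦ i c` multiplies a charge-`q`
word by `i^{q}`, so a pair word (`q = ±2`) changes sign: the TWISTED identification `R ↦ R ∘ 𝒢` of the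
cell's one-point programmes, hubbard-obs PAIRCORR-SDP §13.14 (W8)):

* `fockGauge k = diagonal (s ↦ i^{k·|s|}) = e^{iπk N̂/2}` (`k : ℕ`; period `4`): `fockGauge_zero`,
  `fockGauge_mul` (group law), `fockGauge_four_mul` (period), `conjTranspose_fockGauge`
  (`𝒢_kᴴ = 𝒢_{3k}`), `fockGauge_conjTranspose_mul_self` / `_mul_conjTranspose_self` (unitary);
* `Commute.fockGauge_of_totalNumberOp` — every particle-number-conserving matrix (`[N̂, A] = 0`:
  Hamiltonians, spin-resolved number operators, orbital relabelings) commutes with every `𝒢_k`;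
  `fockGauge_mulVec_of_isNParticle` — on an `N`-particle vector `𝒢_k` acts as the scalar `i^{kN}`;
* the CONJUGATION LAW of ladder operators and words: `fockGauge_mul_creation`
  (`𝒢_k c† = i^{k} c† 𝒢_k`), `fockGauge_mul_annihilation` (`𝒢_k c = i^{3k} c 𝒢_k`),
  `fockGauge_mul_ladderWord` (`𝒢_k W = φ_k(W) • W 𝒢_k`, `φ_k = gaugePhase k`, the product of the
  letter phases), `fockGauge_conj_ladderWord` (`𝒢_k W 𝒢_kᴴ = φ_k(W) • W`), and
  `gaugePhase_eq_I_zpow_charge` (`φ_k(W) = i^{k·q(W)}`, `q` = `ladderCharge`), whence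
  `gaugePhase_of_charge_zero` (neutral words are invariant) and `gaugePhase_of_charge_two` /
  `_neg_two` (pair words pick up `(−1)^k`).

Everything is PROVED (finite matrices); no named fact. Bratteli–Robinson II §5.2.2 (gauge group of
the CAR algebra, `α_θ(a(f)) = a(e^{iθ}f)`), Tasaki (2020) §9.2 (number operator on Fock space), Han
(2020) §2 (charged words and the `U(1)` selection rule of the bootstrap).

References: O. Bratteli, D. W. Robinson, *Operator Algebras and Quantum Statistical Mechanics 2*,
§5.2.2 [BratteliRobinsonII1997]; H. Tasaki, *Physics and Mathematics of Quantum Many-Body Systems*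
(2020) §9.2 [Tasaki2020]; X. Han, arXiv:2006.06002 §2 [Han2020Bootstrap].
-/

noncomputable section

open Matrix Finset Complex

namespace Literature.MathematicalPhysics.QuantumLattice

variable {ι : Type*} [Fintype ι] [LinearOrder ι]

/-! ## The gauge unitaries `𝒢_k = i^{k N̂}` -/

/-- The gauge quarter-turn raised to the power `k`: `𝒢_k = e^{iπkN̂/2} = diagonal (s ↦ i^{k·|s|})` on
fermionic Fock space over the orbitals `ι`. [cite: BratteliRobinsonII1997, §5.2.2] -/
def fockGauge (k : ℕ) : Matrix (Finset ι) (Finset ι) ℂ :=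
  diagonal fun s => I ^ (k * s.card)

omit [Fintype ι] in
/-- Unfolding. [cite: BratteliRobinsonII1997, §5.2.2] -/
theorem fockGauge_apply (k : ℕ) (s t : Finset ι) :
    fockGauge k s t = if s = t then I ^ (k * s.card) else 0 := by
  rw [fockGauge, diagonal_apply]

omit [Fintype ι] in
/-- `𝒢_0 = 1`. [cite: BratteliRobinsonII1997, §5.2.2] -/
@[simp] theorem fockGauge_zero : (fockGauge 0 : Matrix (Finset ι) (Finset ι) ℂ) = 1 := by
  simp [fockGauge]

/-- Group law `𝒢_k 𝒢_l = 𝒢_{k+l}`. [cite: BratteliRobinsonII1997, §5.2.2] -/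
theorem fockGauge_mul (k l : ℕ) :
    (fockGauge k : Matrix (Finset ι) (Finset ι) ℂ) * fockGauge l = fockGauge (k + l) := by
  rw [fockGauge, fockGauge, diagonal_mul_diagonal, fockGauge]
  congr 1
  ext s
  rw [← pow_add, add_mul]

/-- The gauge unitaries commute among themselves. [cite: BratteliRobinsonII1997, §5.2.2] -/
theorem fockGauge_comm (k l : ℕ) :
    (fockGauge k : Matrix (Finset ι) (Finset ι) ℂ) * fockGauge l = fockGauge l * fockGauge k := by
  rw [fockGauge_mul, fockGauge_mul, add_comm]

omit [Fintype ι] in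
/-- Period four: `𝒢_{4m} = 1` (`i⁴ = 1`). [cite: BratteliRobinsonII1997, §5.2.2] -/
@[simp] theorem fockGauge_four_mul (m : ℕ) : (fockGauge (4 * m) : Matrix (Finset ι) (Finset ι) ℂ) = 1 := by
  rw [fockGauge, ← diagonal_one]
  congr 1
  ext s
  rw [mul_assoc, pow_mul, I_pow_four, one_pow]

/-- `𝒢_{k+4} = 𝒢_k`. [cite: BratteliRobinsonII1997, §5.2.2] -/
theorem fockGauge_add_four (k : ℕ) : (fockGauge (k + 4) : Matrix (Finset ι) (Finset ι) ℂ) = fockGauge k := by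
  rw [← fockGauge_mul, show (4 : ℕ) = 4 * 1 from rfl, fockGauge_four_mul, Matrix.mul_one]

omit [Fintype ι] in
/-- Adjoint: `𝒢_kᴴ = 𝒢_{3k}` (`ī = i³`). [cite: BratteliRobinsonII1997, §5.2.2] -/
theorem conjTranspose_fockGauge (k : ℕ) :
    (fockGauge k : Matrix (Finset ι) (Finset ι) ℂ)ᴴ = fockGauge (3 * k) := by
  rw [fockGauge, diagonal_conjTranspose, fockGauge]
  congr 1
  ext s
  rw [Pi.star_apply, star_pow, star_def, conj_I, ← I_pow_three, ← pow_mul, mul_assoc]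

/-- Unitarity `𝒢_kᴴ 𝒢_k = 1`. [cite: BratteliRobinsonII1997, §5.2.2] -/
theorem fockGauge_conjTranspose_mul_self (k : ℕ) :
    (fockGauge k : Matrix (Finset ι) (Finset ι) ℂ)ᴴ * fockGauge k = 1 := by
  rw [conjTranspose_fockGauge, fockGauge_mul, show 3 * k + k = 4 * k by ring, fockGauge_four_mul]

/-- Unitarity `𝒢_k 𝒢_kᴴ = 1`. [cite: BratteliRobinsonII1997, §5.2.2] -/
theorem fockGauge_mul_conjTranspose_self (k : ℕ) :
    (fockGauge k : Matrix (Finset ι) (Finset ι) ℂ) * (fockGauge k)ᴴ = 1 := by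
  rw [conjTranspose_fockGauge, fockGauge_mul, show k + 3 * k = 4 * k by ring, fockGauge_four_mul]

/-! ## Number-conserving matrices commute with the gauge unitaries -/

/-- A matrix commuting with `N̂` has nonzero entries only between configurations of equal
cardinality. [cite: Tasaki2020, §9.2] -/
theorem card_eq_of_commute_totalNumberOp {A : Matrix (Finset ι) (Finset ι) ℂ}
    (hA : Commute totalNumberOp A) {s t : Finset ι} (hst : A s t ≠ 0) : s.card = t.card := by
  have h := congr_fun (congr_fun hA.eq s) t
  rw [totalNumberOp_eq_diagonal, diagonal_mul, mul_diagonal] at h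
  have h' : ((s.card : ℂ) - (t.card : ℂ)) * A s t = 0 := by rw [sub_mul, h, mul_comm, sub_self]
  rcases mul_eq_zero.1 h' with h0 | h0
  · exact_mod_cast (sub_eq_zero.1 h0)
  · exact absurd h0 hst

/-- **Every number-conserving matrix commutes with every gauge unitary** (`[N̂, A] = 0 ⇒ [𝒢_k, A] = 0`):
Hamiltonians, `N_σ`, orbital relabelings. [cite: BratteliRobinsonII1997, §5.2.2] -/
theorem Commute.fockGauge_of_totalNumberOp {A : Matrix (Finset ι) (Finset ι) ℂ}
    (hA : Commute totalNumberOp A) (k : ℕ) : Commute (fockGauge k) A := by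
  change fockGauge k * A = A * fockGauge k
  ext s t
  rw [fockGauge, diagonal_mul, mul_diagonal]
  by_cases hst : A s t = 0
  · rw [hst, mul_zero, zero_mul]
  · rw [card_eq_of_commute_totalNumberOp hA hst, mul_comm]

/-- On an `N`-particle vector the gauge unitary is the scalar `i^{kN}`. [cite: Tasaki2020, §9.2] -/
theorem fockGauge_mulVec_of_isNParticle {N : ℕ} {ψ : Fock ι} (hψ : IsNParticle N ψ) (k : ℕ) :
    fockGauge k *ᵥ ψ = (I ^ (k * N)) • ψ := by
  ext s
  rw [fockGauge, mulVec_diagonal, Pi.smul_apply, smul_eq_mul]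
  by_cases hs : s.card = N
  · rw [hs]
  · rw [hψ s hs, mul_zero, mul_zero]

/-! ## Conjugation of ladder operators: `𝒢_k c† 𝒢_kᴴ = i^k c†`, `𝒢_k c 𝒢_kᴴ = i^{-k} c` -/

/-- `𝒢_k c†_j = i^{k} · c†_j 𝒢_k` (a creator raises `|s|` by one). [cite: BratteliRobinsonII1997, §5.2.2] -/
theorem fockGauge_mul_creation (k : ℕ) (j : ι) :
    (fockGauge k : Matrix (Finset ι) (Finset ι) ℂ) * creation j = (I ^ k) • (creation j * fockGauge k) := by
  ext t s
  rw [fockGauge, diagonal_mul, Matrix.smul_apply, mul_diagonal, creation_apply, smul_eq_mul]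
  split_ifs with h
  · rw [h.2, card_insert_of_notMem h.1, Nat.mul_succ, pow_add]; ring
  · simp

/-- `𝒢_k c_j = i^{3k} · c_j 𝒢_k` (an annihilator lowers `|s|` by one; `i^{3k} = i^{-k}`).
[cite: BratteliRobinsonII1997, §5.2.2] -/
theorem fockGauge_mul_annihilation (k : ℕ) (j : ι) :
    (fockGauge k : Matrix (Finset ι) (Finset ι) ℂ) * annihilation j =
      (I ^ (3 * k)) • (annihilation j * fockGauge k) := by
  ext s t
  rw [fockGauge, diagonal_mul, Matrix.smul_apply, mul_diagonal, annihilation_apply, smul_eq_mul]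
  split_ifs with h
  · rw [h.2, card_insert_of_notMem h.1, Nat.mul_succ, pow_add]
    have h4 : I ^ (3 * k) * I ^ k = 1 := by
      rw [← pow_add, show 3 * k + k = 4 * k by ring, pow_mul, I_pow_four, one_pow]
    calc I ^ (k * s.card) * jwSign j s = I ^ (k * s.card) * jwSign j s * (I ^ (3 * k) * I ^ k) := by
          rw [h4, mul_one]
      _ = I ^ (3 * k) * (jwSign j s * (I ^ (k * s.card) * I ^ k)) := by ring
  · simp

/-- The gauge phase of a letter: `i^k` for a creator, `i^{3k} = i^{-k}` for an annihilator. [cite: Han2020Bootstrap, §2] -/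
def gaugeLetterPhase (k : ℕ) (p : ι × Bool) : ℂ := if p.2 then I ^ k else I ^ (3 * k)

/-- The gauge phase of a word: the product of its letter phases. [cite: Han2020Bootstrap, §2] -/
def gaugePhase (k : ℕ) (l : List (ι × Bool)) : ℂ := (l.map (gaugeLetterPhase k)).prod

omit [Fintype ι] [LinearOrder ι] in
/-- `gaugePhase k [] = 1`. [cite: Han2020Bootstrap, §2] -/
@[simp] theorem gaugePhase_nil (k : ℕ) : gaugePhase k ([] : List (ι × Bool)) = 1 := by
  simp [gaugePhase]

omit [Fintype ι] [LinearOrder ι] in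
/-- `gaugePhase k (p :: l) = gaugeLetterPhase k p * gaugePhase k l`. [cite: Han2020Bootstrap, §2] -/
@[simp] theorem gaugePhase_cons (k : ℕ) (p : ι × Bool) (l : List (ι × Bool)) :
    gaugePhase k (p :: l) = gaugeLetterPhase k p * gaugePhase k l := by
  simp [gaugePhase]

/-- `𝒢_k a = φ_k(a) · a 𝒢_k` for a single letter `a ∈ {c†_j, c_j}`. [cite: BratteliRobinsonII1997, §5.2.2] -/
theorem fockGauge_mul_ladderLetter (k : ℕ) (p : ι × Bool) :
    (fockGauge k : Matrix (Finset ι) (Finset ι) ℂ) * ladderLetter p =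
      gaugeLetterPhase k p • (ladderLetter p * fockGauge k) := by
  unfold ladderLetter gaugeLetterPhase
  obtain ⟨j, b⟩ := p
  cases b
  · simpa using fockGauge_mul_annihilation k j
  · simpa using fockGauge_mul_creation k j

/-- **Conjugation law of ladder words**: `𝒢_k W = φ_k(W) · W 𝒢_k`. [cite: BratteliRobinsonII1997, §5.2.2] -/
theorem fockGauge_mul_ladderWord (k : ℕ) (l : List (ι × Bool)) :
    (fockGauge k : Matrix (Finset ι) (Finset ι) ℂ) * ladderWord l = gaugePhase k l • (ladderWord l * fockGauge k) := by
  induction l with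
  | nil => simp
  | cons p l ih =>
    rw [ladderWord_cons, gaugePhase_cons, ← Matrix.mul_assoc, fockGauge_mul_ladderLetter, Matrix.smul_mul,
      Matrix.mul_assoc, ih, Matrix.mul_smul, ← Matrix.mul_assoc, smul_smul]

/-- `𝒢_k W 𝒢_kᴴ = φ_k(W) · W`. [cite: BratteliRobinsonII1997, §5.2.2] -/
theorem fockGauge_conj_ladderWord (k : ℕ) (l : List (ι × Bool)) :
    (fockGauge k : Matrix (Finset ι) (Finset ι) ℂ) * ladderWord l * (fockGauge k)ᴴ = gaugePhase k l • ladderWord l := by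
  rw [fockGauge_mul_ladderWord, Matrix.smul_mul, Matrix.mul_assoc, fockGauge_mul_conjTranspose_self, Matrix.mul_one]

/-- `𝒢_kᴴ W 𝒢_k = φ_{3k}(W) · W` (the inverse rotation). [cite: BratteliRobinsonII1997, §5.2.2] -/
theorem fockGauge_conjTranspose_conj_ladderWord (k : ℕ) (l : List (ι × Bool)) :
    (fockGauge k : Matrix (Finset ι) (Finset ι) ℂ)ᴴ * ladderWord l * fockGauge k = gaugePhase (3 * k) l • ladderWord l := by
  have h := fockGauge_conj_ladderWord (ι := ι) (3 * k) l
  rwa [conjTranspose_fockGauge, show 3 * (3 * k) = 4 * (2 * k) + k by ring, ← fockGauge_mul,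
    fockGauge_four_mul, Matrix.one_mul, ← conjTranspose_fockGauge] at h

/-! ## The phase is `i^{k·q}`, `q` the charge of the word -/

/-- `i^{3k} = i^{-k}` as an integer power (private arithmetic helper). [folklore] -/
private theorem I_pow_three_mul_eq_zpow_neg (k : ℕ) : I ^ (3 * k) = I ^ (-(k : ℤ)) := by
  rw [_root_.zpow_neg, zpow_natCast, ← inv_pow, inv_I, ← I_pow_three, ← pow_mul]

omit [Fintype ι] [LinearOrder ι] in
/-- **`φ_k(W) = i^{k·q(W)}`** with `q = ladderCharge W = #creators − #annihilators` (an integer power: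
`i^{3k} = i^{-k}`). [cite: Han2020Bootstrap, §2] -/
theorem gaugePhase_eq_I_zpow_charge (k : ℕ) (l : List (ι × Bool)) :
    gaugePhase k l = I ^ ((k : ℤ) * ladderCharge l) := by
  induction l with
  | nil => simp
  | cons p l ih =>
    rw [gaugePhase_cons, ih, ladderCharge_cons, mul_add, zpow_add₀ I_ne_zero]
    congr 1
    unfold gaugeLetterPhase
    obtain ⟨j, b⟩ := p
    cases b
    · simp only [Bool.false_eq_true, if_false, mul_neg, mul_one]
      exact I_pow_three_mul_eq_zpow_neg k
    · simp only [if_true, mul_one, zpow_natCast]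

omit [Fintype ι] [LinearOrder ι] in
/-- Neutral words are gauge invariant: `q(W) = 0 ⇒ φ_k(W) = 1`. [cite: Han2020Bootstrap, §2] -/
theorem gaugePhase_of_charge_zero (k : ℕ) {l : List (ι × Bool)} (hl : ladderCharge l = 0) :
    gaugePhase k l = 1 := by
  rw [gaugePhase_eq_I_zpow_charge, hl, mul_zero, zpow_zero]

omit [Fintype ι] [LinearOrder ι] in
/-- Pair-creation words (`q = 2`) pick up `(−1)^k`. [cite: Han2020Bootstrap, §2] -/
theorem gaugePhase_of_charge_two (k : ℕ) {l : List (ι × Bool)} (hl : ladderCharge l = 2) :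
    gaugePhase k l = (-1) ^ k := by
  rw [gaugePhase_eq_I_zpow_charge, hl, show ((k : ℤ) * 2) = ((2 * k : ℕ) : ℤ) by push_cast; ring, zpow_natCast,
    pow_mul, I_sq]

omit [Fintype ι] [LinearOrder ι] in
/-- Pair-annihilation words (`q = −2`) pick up `(−1)^k`. [cite: Han2020Bootstrap, §2] -/
theorem gaugePhase_of_charge_neg_two (k : ℕ) {l : List (ι × Bool)} (hl : ladderCharge l = -2) :
    gaugePhase k l = (-1) ^ k := by
  rw [gaugePhase_eq_I_zpow_charge, hl, show ((k : ℤ) * -2) = -(((2 * k : ℕ) : ℤ)) by push_cast; ring, _root_.zpow_neg,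
    zpow_natCast, pow_mul, I_sq, ← inv_pow, inv_neg, inv_one]

/-- A neutral word commutes with every gauge unitary. [cite: Han2020Bootstrap, §2] -/
theorem fockGauge_commute_ladderWord_of_charge_zero (k : ℕ) {l : List (ι × Bool)} (hl : ladderCharge l = 0) :
    Commute (fockGauge k : Matrix (Finset ι) (Finset ι) ℂ) (ladderWord l) := by
  change fockGauge k * ladderWord l = ladderWord l * fockGauge k
  rw [fockGauge_mul_ladderWord, gaugePhase_of_charge_zero k hl, one_smul]

end Literature.MathematicalPhysics.QuantumLattice

end
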